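import Summits.ValiantsHypothesis.ValiantsHypothesis.Theorems.DerivedPencilRolleQuasi.Negative.DerivedPencilRolleQuasiSpacelikeFamily

/-!
# `DerivedPencilRolleQuasi` — negative lemma: the term factor `(K+1)^(A·K)` is load-bearing

Crux `stmt-ValiantsHypothesis-18064` (`Theses.SymmetroidDescartes.DerivedPencilRolleQuasi`, route
SymmetroidDescartes, the repaired inductive step on the number of terms):
`∃ C A, ∀ m K S d (symmetric, invertible, d strictly increasing),
  Z₊(det F) ≤ C · Z₊(det ∂F) + (K+1)^(A·K) · 2^((log₂ m + 2)^A)`.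

Refuter (cdisprove) finding, 2026-08-17, read off the spacelike `2 × 2` family of
`DerivedPencilRolleQuasiSpacelikeFamily.lean` (size `m = 2`, `K = D` terms, symmetric invertible
coefficients, `Z₊(det ∂F_D) = 0` with `det ∂F_D < 0` on `(0,∞)`, `Z₊(det F_D) ≥ 2D`):

* `twoMul_le_termFreeBudget_of_step` : any constants/budget `(C, B)` for which the STEP SHAPE
  `Z₊(F) ≤ C·Z₊(∂F) + B m K` holds must have `2K ≤ B 2 K` for all `K ≥ 1` — the budget grows at least
  linearly in the number of terms already at size `2`, whatever the Rolle multiplier `C`;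
* `derivedPencilRolleQuasi_false_of_termFree_budget` : NO budget depending on the size `m` alone works:
  `¬ ∀ m K S d …, Z₊(F) ≤ C·Z₊(∂F) + B m` for every `C` and every `B : ℕ → ℕ`;
* `derivedPencilRolleQuasi_false_without_termFactor` : in particular the crux with the factor
  `(K+1)^(A·K)` DROPPED (budget `2^((log₂ m+2)^A)`) is false for all `C, A` — the term factor is
  load-bearing: any proof of the crux must let the slack grow with `K`;
* `twoMul_le_quasiBudget_of_constants` : what the family says about the crux itself —
  `2K ≤ (K+1)^(A·K)·2^(3^A)`, consistent (the crux survives this model; at fixed size Descartes caps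
  `Z₊` by `C(K+2,2) − 1`, polynomial in `K` — cf. Koiran–Portier–Tavenas arXiv:1205.1015 Thm 12).

Sorry-free; nothing asserts a route statement positively (Negative/ lane). [folklore]
-/

-- `Summit.ValiantsHypothesis.ValiantsHypothesis.…` repeats a component by the D-0017 layout.
set_option linter.dupNamespace false

namespace Summit.ValiantsHypothesis.ValiantsHypothesis.Theorems.DerivedPencilRolleQuasi.Negative

open scoped BigOperators Matrix Polynomial
open Polynomial

/-! ## Consequences for the crux -/

/-- **Linear growth in the number of terms at size `2`.** If the step shape
`Z₊(F) ≤ C·Z₊(∂F) + B m K` holds for all admissible pencils, then `2K ≤ B 2 K` for every `K ≥ 1`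
(whatever the Rolle multiplier `C`). [folklore] -/
theorem twoMul_le_termFreeBudget_of_step (C : ℕ) (B : ℕ → ℕ → ℕ)
    (h : ∀ (m K : ℕ) (S : Fin (K + 1) → Matrix (Fin m) (Fin m) ℝ) (d : Fin (K + 1) → ℕ),
      (∀ l, (S l).IsSymm) → (∀ l, (S l).det ≠ 0) → StrictMono d →
        ((∑ l, (Polynomial.X : Polynomial ℝ) ^ d l • (S l).map Polynomial.C).det.roots.toFinset.filter
            (fun t => 0 < t)).card ≤
          C * ((∑ l : Fin K, (Polynomial.X : Polynomial ℝ) ^ (d l.succ - d 0 - 1) •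
            (((d l.succ - d 0 : ℕ) : ℝ) • S l.succ).map Polynomial.C).det.roots.toFinset.filter
              (fun t => 0 < t)).card + B m K)
    (K : ℕ) (hK : 1 ≤ K) : 2 * K ≤ B 2 K := by
  have h1 := h 2 K (spS K) (spD K) (spS_isSymm K) (spS_det_ne_zero K) (spD_strictMono K)
  rw [card_posRoots_derived_spF K hK, mul_zero, zero_add] at h1
  exact (twoMul_le_card_posRoots_spF K).trans h1

/-- **No size-only budget.** For every multiplier `C` and every budget `B m` depending on the size
alone, the step `Z₊(F) ≤ C·Z₊(∂F) + B m` fails (at `m = 2`, `K = B 2` terms). [folklore] -/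
theorem derivedPencilRolleQuasi_false_of_termFree_budget (C : ℕ) (B : ℕ → ℕ) :
    ¬ ∀ (m K : ℕ) (S : Fin (K + 1) → Matrix (Fin m) (Fin m) ℝ) (d : Fin (K + 1) → ℕ),
      (∀ l, (S l).IsSymm) → (∀ l, (S l).det ≠ 0) → StrictMono d →
        ((∑ l, (Polynomial.X : Polynomial ℝ) ^ d l • (S l).map Polynomial.C).det.roots.toFinset.filter
            (fun t => 0 < t)).card ≤
          C * ((∑ l : Fin K, (Polynomial.X : Polynomial ℝ) ^ (d l.succ - d 0 - 1) •
            (((d l.succ - d 0 : ℕ) : ℝ) • S l.succ).map Polynomial.C).det.roots.toFinset.filter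
              (fun t => 0 < t)).card + B m := by
  intro h
  have h1 := twoMul_le_termFreeBudget_of_step C (fun m _ => B m) h (B 2 + 1) (Nat.succ_pos _)
  omega

/-- **The term factor is load-bearing:** `DerivedPencilRolleQuasi` with `(K+1)^(A·K)` DROPPED
(budget `2^((log₂ m + 2)^A)` only) is false, for all `C, A` — any proof of the crux must let the slack
grow with the number of terms. [folklore] -/
theorem derivedPencilRolleQuasi_false_without_termFactor :
    ¬ ∃ C A : ℕ, ∀ (m K : ℕ) (S : Fin (K + 1) → Matrix (Fin m) (Fin m) ℝ) (d : Fin (K + 1) → ℕ),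
      (∀ l, (S l).IsSymm) → (∀ l, (S l).det ≠ 0) → StrictMono d →
        ((∑ l, (Polynomial.X : Polynomial ℝ) ^ d l • (S l).map Polynomial.C).det.roots.toFinset.filter
            (fun t => 0 < t)).card ≤
          C * ((∑ l : Fin K, (Polynomial.X : Polynomial ℝ) ^ (d l.succ - d 0 - 1) •
            (((d l.succ - d 0 : ℕ) : ℝ) • S l.succ).map Polynomial.C).det.roots.toFinset.filter
              (fun t => 0 < t)).card + 2 ^ (Nat.log 2 m + 2) ^ A :=
  fun ⟨C, A, h⟩ =>
    derivedPencilRolleQuasi_false_of_termFree_budget C (fun m => 2 ^ (Nat.log 2 m + 2) ^ A) h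

/-- The same, phrased against the crux's constants: if `(C, A)` witness `DerivedPencilRolleQuasi`, the
budget they certify at size `2` is at least `2K` — i.e. `2K ≤ (K+1)^(A·K) · 2^(3^A)` is all the family
says about the crux itself (consistent: the crux survives this model). [folklore] -/
theorem twoMul_le_quasiBudget_of_constants (C A : ℕ)
    (h : ∀ (m K : ℕ) (S : Fin (K + 1) → Matrix (Fin m) (Fin m) ℝ) (d : Fin (K + 1) → ℕ),
      (∀ l, (S l).IsSymm) → (∀ l, (S l).det ≠ 0) → StrictMono d →
        ((∑ l, (Polynomial.X : Polynomial ℝ) ^ d l • (S l).map Polynomial.C).det.roots.toFinset.filter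
            (fun t => 0 < t)).card ≤
          C * ((∑ l : Fin K, (Polynomial.X : Polynomial ℝ) ^ (d l.succ - d 0 - 1) •
            (((d l.succ - d 0 : ℕ) : ℝ) • S l.succ).map Polynomial.C).det.roots.toFinset.filter
              (fun t => 0 < t)).card + (K + 1) ^ (A * K) * 2 ^ (Nat.log 2 m + 2) ^ A)
    (K : ℕ) (hK : 1 ≤ K) : 2 * K ≤ (K + 1) ^ (A * K) * 2 ^ (Nat.log 2 2 + 2) ^ A :=
  twoMul_le_termFreeBudget_of_step C (fun m K => (K + 1) ^ (A * K) * 2 ^ (Nat.log 2 m + 2) ^ A) h K hK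

end Summit.ValiantsHypothesis.ValiantsHypothesis.Theorems.DerivedPencilRolleQuasi.Negative
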